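import Summits.QuantumFields.YangMills.Theorems.LuscherReductionTwistedTraceScalingBODefect
import HarnessLib

/-!
# The (B-OD) door WITH POTENTIAL in lane A's currency (un-normalised profile): `stub_hODpot_A`'s two inequalities from an `L²(w)` defect budget
# `∫E²w ≤ Λ²·(b²·T(φ⊗Ω) + P(φ))`

Support file for the crux `NearFlatRatioLaw` (line `ratepack_v2`, stub `stub_hODpot_A`; successor step (E) of
`Cruxes/NearFlatRatioLaw/Lines/ratepack-v7-moments-g18.md` §14; memo v8 (g19)).  Lane A's door `…BODefect.hOD_of_defect` turns `∫E²w ≤ (bΛ)²T` into the two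
inequalities of `hOD`; the rate twin's stub has a second-moment POTENTIAL under the root: `|X| ≤ Λ·√(b²T + P)·√T(v)`.  (`…ODPotDoor` is the same door for the
ADAPTED profile of the v3–v5 skeleton; the v6 stub is stated for the plain `boFun φ Ω_c`, so the plain door is needed.)
* ★★ `tubeCross_boFun_le_pot_of_defect` — β-pointwise: `∫E²w ≤ Λ²(b²T + P)`, `Λ ≥ 0` ⇒ both inequalities;
* ★★★ `hODpotA_of_defect` — the `∀ᶠ β` family wrapper with EXACTLY the binder structure of the last conjunct of `stub_hODpot_A` (gauge invariance of `φ` is carried as an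
  unused hypothesis; potential `P β φ` abstract).
-/

set_option autoImplicit false

noncomputable section

open MeasureTheory Filter Topology Real
open scoped BigOperators
open Literature.MathematicalPhysics.QuantumFieldTheory
open Literature.MathematicalPhysics.QuantumLattice

namespace Summit.QuantumFields.YangMills.Theorems.FemtoTransferGap.TwoLattice.ConstTube

open Summit.QuantumFields.YangMills.Theorems.FemtoTransferGap
open Summit.QuantumFields.YangMills.Theorems.FemtoTransferGap.TwoLattice
open Summit.QuantumFields.YangMills.Theorems.FemtoTransferGap.TwoLattice.Avg
open Summit.QuantumFields.YangMills.Theorems.FemtoTransferGap.TwoLattice.Stiff (LinkSpace)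

variable {L : ℕ} [NeZero L]

/-- ★★ **THE (B-OD) DOOR WITH POTENTIAL, β-pointwise.**  With the data of `tubeCross_boFun_le_of_defect`, if `∫ E²w ≤ Λ²·(b²·T(φ⊗Ω) + P)` with `Λ ≥ 0` then
`|X(boFun φ Ω, v)|, |X(v, boFun φ Ω)| ≤ Λ·√(b²·T(φ⊗Ω) + P)·√(T v)`. [cite: Luscher1983, §3] [cite: SjostrandZworski2007, §2] -/
theorem tubeCross_boFun_le_pot_of_defect (β : ℝ) {Ω : LinkSpace L → ℝ} (hΩm : Measurable Ω) {CΩ : ℝ} (hCΩ : ∀ x, |Ω x| ≤ CΩ)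
    {w : GaugeConfig 3 L SU2 → ℝ} (hwm : Measurable w) {Cw : ℝ} (hCw : ∀ U, |w U| ≤ Cw) (hw0 : ∀ U, 0 ≤ w U)
    {φ : GaugeConfig 3 1 SU2 → ℝ} (hφm : Measurable φ) {Cφ : ℝ} (hCφ : ∀ u, |φ u| ≤ Cφ)
    {v : GaugeConfig 3 L SU2 → ℝ} (hvm : Measurable v) {Cv : ℝ} (hCv : ∀ U, |v U| ≤ Cv) (horth : ∀ u, fibreInner L w Ω v u = 0)
    {ψ : GaugeConfig 3 1 SU2 → ℝ} (hψm : Measurable ψ) {Cψ : ℝ} (hCψ : ∀ u, |ψ u| ≤ Cψ)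
    {E : GaugeConfig 3 L SU2 → ℝ} (hEm : Measurable E) {CE : ℝ} (hCE : ∀ U, |E U| ≤ CE)
    (hF : ∀ U, v U ≠ 0 → ∫ V, avgKernel β U V * boFun L φ Ω V ∂configMeasure SU2 L = (boFun L ψ Ω U + E U) * w U)
    {b Λ P : ℝ} (hΛ : 0 ≤ Λ) (hD : ∫ U, E U ^ 2 * w U ∂configMeasure SU2 L ≤ Λ ^ 2 * (b ^ 2 * tubeNormSq w (boFun L φ Ω) + P)) :
    |tubeCross β (boFun L φ Ω) v| ≤ Λ * Real.sqrt (b ^ 2 * tubeNormSq w (boFun L φ Ω) + P) * Real.sqrt (tubeNormSq w v) ∧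
      |tubeCross β v (boFun L φ Ω)| ≤ Λ * Real.sqrt (b ^ 2 * tubeNormSq w (boFun L φ Ω) + P) * Real.sqrt (tubeNormSq w v) := by
  obtain ⟨h1, h2⟩ := tubeCross_boFun_le_of_defect β hΩm hCΩ hwm hCw hw0 hφm hCφ hvm hCv horth hψm hCψ hEm hCE hF
  have hsq : Real.sqrt (∫ U, E U ^ 2 * w U ∂configMeasure SU2 L) ≤ Λ * Real.sqrt (b ^ 2 * tubeNormSq w (boFun L φ Ω) + P) := by
    calc Real.sqrt (∫ U, E U ^ 2 * w U ∂configMeasure SU2 L) ≤ Real.sqrt (Λ ^ 2 * (b ^ 2 * tubeNormSq w (boFun L φ Ω) + P)) := Real.sqrt_le_sqrt hD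
      _ = Λ * Real.sqrt (b ^ 2 * tubeNormSq w (boFun L φ Ω) + P) := by rw [Real.sqrt_mul (sq_nonneg _), Real.sqrt_sq hΛ]
  have hv0 : 0 ≤ Real.sqrt (tubeNormSq w v) := Real.sqrt_nonneg _
  exact ⟨h1.trans (mul_le_mul_of_nonneg_right hsq hv0), h2.trans (mul_le_mul_of_nonneg_right hsq hv0)⟩

/-- ★★★ **`stub_hODpot_A`'s INEQUALITIES FROM THE DEFECT (family form).**  Profile family `Ω β` (`|Ω| ≤ 1`, measurable), weights `softWeight (χ β)`, window `δ₁ β`, level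
`Λ β ≥ 0` (eventually), rate `b β`, potential `P β φ`: if eventually every bounded measurable gauge-invariant `φ` in the window has a dual amplitude `ψ` and a defect
`E` with `K̃(boFun φ (Ω β)) = (boFun ψ (Ω β) + E)·w` on `{χ β ≠ 0}` and `∫E²w ≤ Λ β²·(b β²·T(φ⊗Ω β) + P β φ)`, then for every such `φ` and every bounded measurable `v`
supported in `{χ β ≠ 0}` and fibre-orthogonal to `Ω β`: `|X(boFun φ Ω, v)|, |X(v, boFun φ Ω)| ≤ Λ β·√(b β²·T + P β φ)·√T(v)`. [cite: Luscher1983, §3] -/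
theorem hODpotA_of_defect {Ω : ℝ → LinkSpace L → ℝ} (hΩm : ∀ β, Measurable (Ω β)) (hΩ1 : ∀ β x, |Ω β x| ≤ 1)
    {χ : ℝ → GaugeConfig 3 L SU2 → ℝ} (hw : ∀ β, Measurable (softWeight (χ β)) ∧ (∃ C : ℝ, ∀ U, |softWeight (χ β) U| ≤ C) ∧ ∀ U, 0 ≤ softWeight (χ β) U)
    {δ₁ Λ b : ℝ → ℝ} (hΛ : ∀ᶠ β in atTop, 0 ≤ Λ β) {P : ℝ → (GaugeConfig 3 1 SU2 → ℝ) → ℝ}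
    (hdef : ∀ᶠ β in atTop, ∀ φ : GaugeConfig 3 1 SU2 → ℝ, Measurable φ → (∃ C : ℝ, ∀ u, |φ u| ≤ C) →
      (∀ (g : Site 3 1 → SU2) (u : GaugeConfig 3 1 SU2), φ (gaugeTransform g u) = φ u) → (∀ u, φ u ≠ 0 → orbitDist u < δ₁ β) →
      ∃ (ψ : GaugeConfig 3 1 SU2 → ℝ) (E : GaugeConfig 3 L SU2 → ℝ), Measurable ψ ∧ (∃ C : ℝ, ∀ u, |ψ u| ≤ C) ∧ Measurable E ∧ (∃ C : ℝ, ∀ U, |E U| ≤ C) ∧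
        (∀ U, χ β U ≠ 0 → ∫ V, avgKernel β U V * boFun L φ (Ω β) V ∂configMeasure SU2 L = (boFun L ψ (Ω β) U + E U) * softWeight (χ β) U) ∧
        ∫ U, E U ^ 2 * softWeight (χ β) U ∂configMeasure SU2 L ≤ Λ β ^ 2 * (b β ^ 2 * tubeNormSq (softWeight (χ β)) (boFun L φ (Ω β)) + P β φ)) :
    ∀ᶠ β in atTop, ∀ (φ : GaugeConfig 3 1 SU2 → ℝ) (v : GaugeConfig 3 L SU2 → ℝ), Measurable φ → (∃ C : ℝ, ∀ u, |φ u| ≤ C) →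
      (∀ (g : Site 3 1 → SU2) (u : GaugeConfig 3 1 SU2), φ (gaugeTransform g u) = φ u) →
      (∀ u, φ u ≠ 0 → orbitDist u < δ₁ β) → Measurable v → (∃ C : ℝ, ∀ U, |v U| ≤ C) → (∀ U, v U ≠ 0 → χ β U ≠ 0) →
      (∀ u, fibreInner L (softWeight (χ β)) (Ω β) v u = 0) →
      |tubeCross β (boFun L φ (Ω β)) v| ≤ Λ β * Real.sqrt (b β ^ 2 * tubeNormSq (softWeight (χ β)) (boFun L φ (Ω β)) + P β φ) * Real.sqrt (tubeNormSq (softWeight (χ β)) v) ∧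
      |tubeCross β v (boFun L φ (Ω β))| ≤ Λ β * Real.sqrt (b β ^ 2 * tubeNormSq (softWeight (χ β)) (boFun L φ (Ω β)) + P β φ) * Real.sqrt (tubeNormSq (softWeight (χ β)) v) := by
  filter_upwards [hdef, hΛ] with β hβ hΛβ φ v hφm hφb hφg hφs hvm hvb hvχ horth
  obtain ⟨Cφ, hCφ⟩ := hφb
  obtain ⟨Cv, hCv⟩ := hvb
  obtain ⟨ψ, E, hψm, ⟨Cψ, hCψ⟩, hEm, ⟨CE, hCE⟩, hF, hD⟩ := hβ φ hφm ⟨Cφ, hCφ⟩ hφg hφs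
  obtain ⟨hwm, ⟨Cw, hCw⟩, hw0⟩ := hw β
  exact tubeCross_boFun_le_pot_of_defect β (hΩm β) (hΩ1 β) hwm hCw hw0 hφm hCφ hvm hCv horth hψm hCψ hEm hCE (fun U hU => hF U (hvχ U hU)) hΛβ hD

end Summit.QuantumFields.YangMills.Theorems.FemtoTransferGap.TwoLattice.ConstTube

end
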